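import Mathlib
import Summits.ValiantsHypothesis.ValiantsHypothesis.Theorems.BarrierLeverPartitionMinorsHitByVPHiddenStatesMultiSwapCells
import Summits.ValiantsHypothesis.ValiantsHypothesis.Theorems.BarrierLeverPartitionMinorsHitByVPHiddenStatesSecondShellReduced
import Summits.ValiantsHypothesis.ValiantsHypothesis.Theorems.BarrierLeverPartitionMinorsHitByVPHiddenStatesSecondShellTwoTops

/-!
# Route BarrierLever — item `PartitionMinorsHitByVP` (stmt-ValiantsHypothesis-19717), line `hidden-states`:
# ★★ THE m-SWAP TEMPLATES — prescribed transports, a unique-matching pattern of vanishing cross minors, the master criterion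

Helper file (`--supports stmt-ValiantsHypothesis-19717`; cell valiant-natproofs, 𝒟-side door (c), registered line
`Cruxes/PartitionMinorsHitByVP/Lines/hidden_states.lean` v9; prover seat val-np-p6 gen 20).  Closes NO item; definition-free.

THE TEMPLATES (memo HOME/val-np-p6/g20/MEMO-valnp6-g20.md §5).  Gen 17's `…MultiSwapExchange.exists_table_of_unique_matching` composes `m`
first-shell certificates once the cross minors `D(A_l ← C_{σ l})` of the m-parameter table `I + Σ_l ε_l N_l` vanish on a pattern killing every
permutation `σ ≠ 1`; its only instances so far (`…MultiSwapCells`, `…MultiSwapTops`) choose the transports blindly.  Here the transports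
`e_l` are INPUT (so that oriented cells — keyed paths, blocked bottoms, unfed chains, forced colliders — can be built for every `m` as they were for
`m = 2`):
* `tabM_swapTable'_edges` — the m-parameter table has unit diagonal and its edges lie in the UNION DIGRAPH of the `m` transports;
* ★★ `exists_table_multiSwap_of_cross` — transports + key-form vanishing of the patterned cross minors ⇒ the m-th-shell family is served
  (the bookkeeping of `…MultiSwapCells.exists_table_multiSwap_immobile`, transports exposed);
* ★★ `exists_table_multiSwap_of_noReduced` — transports + ONE potential for the union digraph + «no reduced configuration»
  (`…SecondShellReduced.det_eq_zero_of_no_reduced`) for the patterned cross minors ⇒ served.  For `m = 2` these are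
  `…SecondShellCrossTemplate` / `…SecondShellMasterTemplate`; the forced-collider lemma `…SecondShellForcedColliders` discharges the
  «no reduced configuration» hypothesis minor by minor, for any `m`.

HONEST LABEL: conjecture-column toolkit (m-th shell of the ball, every `m, t, h`); 19717 stays OPEN; nothing on crux 14610 or VP ≠ VNP.
-/

set_option linter.dupNamespace false

namespace Summit.ValiantsHypothesis.ValiantsHypothesis.Theorems.BarrierLever.HiddenStates

open Finset

noncomputable section

namespace SecondShell

open PathTable

/-- the m-parameter table of `m` transports has unit diagonal, and its edges lie in the union digraph of the transports. -/
theorem tabM_swapTable'_edges {h m : ℕ} {k j j' : Fin m → ℕ}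
    (e : ∀ l, (Fin (k l + 1) ⊕ Fin (k l)) ⊕ (Fin (j l) ⊕ Fin (j' l)) ≃ Fin h) (ε : Fin m → ℂ) :
    (∀ u, tabM (fun l a q => swapTable' (e l) a q - if q = a then 1 else 0) ε u u = 1) ∧
    (∀ u v, u ≠ v → tabM (fun l a q => swapTable' (e l) a q - if q = a then 1 else 0) ε u v ≠ 0 →
      ∃ l, swapTable' (e l) u v ≠ 0) := by
  constructor
  · intro u
    simp only [tabM, swapTable'_self, if_true, sub_self, mul_zero, Finset.sum_const_zero, add_zero]
  · intro u v huv hw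
    by_contra hcon
    push Not at hcon
    apply hw
    simp only [tabM, if_neg (Ne.symm huv), hcon, zero_sub, mul_zero, neg_zero, Finset.sum_const_zero, add_zero]

/-- ★★ **THE m-SWAP COMPOSITION TEMPLATE WITH PRESCRIBED TRANSPORTS.**  Matched swaps `(A_l, C_l)` (`|A_l| = t`, `|C_l| = t + 1`,
`A`, `C` injective), transports `e_l` of sizes `k_l + j_l = t`, `k_l ≥ 1` (so `A_l ⊄ C_l`), a row family in the m-th-shell family with columns
covering the ball, and for every permutation `σ ≠ 1` some `l` whose cross minor `D(A_l ← C_{σ l})` of the m-parameter table vanishes in key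
form for every parameter ⇒ the family is served. -/
theorem exists_table_multiSwap_of_cross (h t : ℕ) {m : ℕ} (hm : 0 < m) (A C : Fin m → Finset (Fin h))
    (hA : ∀ l, (A l).card = t) (hC : ∀ l, (C l).card = t + 1)
    (hAinj : Function.Injective A) (hCinj : Function.Injective C)
    {k j j' : Fin m → ℕ} (hk : ∀ l, 1 ≤ k l) (hkj : ∀ l, k l + j l = t)
    (e : ∀ l, (Fin (k l + 1) ⊕ Fin (k l)) ⊕ (Fin (j l) ⊕ Fin (j' l)) ≃ Fin h)
    (m1 : ∀ l x, e l (Sum.inl (Sum.inl x)) ∈ C l \ A l) (m2 : ∀ l i, e l (Sum.inl (Sum.inr i)) ∈ A l \ C l)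
    (m3 : ∀ l z, e l (Sum.inr (Sum.inl z)) ∈ A l ∩ C l) (m4 : ∀ l x, e l (Sum.inr (Sum.inr x)) ∈ (A l ∪ C l)ᶜ)
    {r : ℕ} (u cols : Fin r → Finset (Fin h)) (hu : Function.Injective u)
    (hU : ∀ i, ((u i).card ≤ t ∧ ∀ l, u i ≠ A l) ∨ ∃ l, u i = C l)
    (hcols : ∀ J : Finset (Fin h), J.card ≤ t → ∃ kk, cols kk = J)
    (hZ : ∀ σ : Equiv.Perm (Fin m), σ ≠ 1 → ∃ l, ∀ (rows : Fin r → Finset (Fin h)) (i₀ : Fin r), rows i₀ = C (σ l) →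
        (∀ S : Finset (Fin h), S.card ≤ t → S ≠ A l → ∃ i, i ≠ i₀ ∧ rows i = S) → (∀ kk, (cols kk).card ≤ t) →
        ∀ ε, (mat (tabM (fun l a q => swapTable' (e l) a q - if q = a then 1 else 0) ε) rows cols).det = 0) :
    ∃ tx : Option (Fin h) → Fin h → ℂ,
      (Matrix.of fun i kk : Fin r => ∏ a ∈ u i, (tx none a + ∑ q ∈ cols kk, tx (some q) a)).det ≠ 0 := by
  classical
  let N : Fin m → Fin h → Fin h → ℂ := fun l a q => swapTable' (e l) a q - if q = a then 1 else 0
  have hTl : ∀ l, tabM N (Pi.single l 1) = swapTable' (e l) := by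
    intro l; funext a q
    simp only [tabM, N]
    rw [Finset.sum_eq_single l]
    · simp
    · intro l' _ hl'; simp [hl']
    · intro hl; exact (hl (Finset.mem_univ l)).elim
  -- bookkeeping (verbatim from `exists_table_multiSwap_immobile`)
  set Ball := Finset.univ.filter fun S : Finset (Fin h) => S.card ≤ t with hBall
  set 𝒰 := (Ball \ Finset.univ.image A) ∪ Finset.univ.image C with h𝒰
  have hAB : ∀ l, A l ∈ Ball := fun l => Finset.mem_filter.2 ⟨Finset.mem_univ _, by rw [hA l]⟩
  have hCB : ∀ l, C l ∉ Ball := fun l hl => by have := (Finset.mem_filter.1 hl).2; rw [hC l] at this; omega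
  have h𝒰card : 𝒰.card = Ball.card := by
    rw [h𝒰, Finset.card_union_of_disjoint]
    · rw [Finset.card_sdiff_of_subset (fun x hx => by obtain ⟨l, -, rfl⟩ := Finset.mem_image.1 hx; exact hAB l),
        Finset.card_image_of_injective _ hAinj, Finset.card_image_of_injective _ hCinj, Finset.card_univ, Fintype.card_fin]
      have : m ≤ Ball.card := by
        calc m = (Finset.univ.image A).card := by
              rw [Finset.card_image_of_injective _ hAinj, Finset.card_univ, Fintype.card_fin]
          _ ≤ Ball.card := Finset.card_le_card fun x hx => by
              obtain ⟨l, -, rfl⟩ := Finset.mem_image.1 hx; exact hAB l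
      omega
    · rw [Finset.disjoint_left]
      intro x hx hx'
      obtain ⟨l, -, rfl⟩ := Finset.mem_image.1 hx'
      exact hCB l (Finset.mem_sdiff.1 hx).1
  have hUmem : ∀ i, u i ∈ 𝒰 := by
    intro i
    rcases hU i with ⟨hc, hne⟩ | ⟨l, hl⟩
    · refine Finset.mem_union_left _ (Finset.mem_sdiff.2 ⟨Finset.mem_filter.2 ⟨Finset.mem_univ _, hc⟩, fun hx => ?_⟩)
      obtain ⟨l, -, hl⟩ := Finset.mem_image.1 hx
      exact hne l hl.symm
    · exact Finset.mem_union_right _ (Finset.mem_image.2 ⟨l, Finset.mem_univ _, hl.symm⟩)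
  obtain ⟨hhit, hcolcard⟩ := rows_cover t 𝒰 h𝒰card u cols hu hUmem hcols
  have hidx' := fun l => hhit (C l) (Finset.mem_union_right _ (Finset.mem_image.2 ⟨l, Finset.mem_univ _, rfl⟩))
  choose idx hidx using hidx'
  have hidxinj : Function.Injective idx := fun l l' hll' => hCinj (by rw [← hidx l, ← hidx l', hll'])
  have hslot : ∀ i l, u i = C l → i = idx l := fun i l hil => hu (by rw [hil, hidx l])
  let b : Fin r → Finset (Fin h) := replaced u idx A
  have hbslot : ∀ l, b (idx l) = A l := fun l => replaced_idx u hidxinj A l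
  have hboff : ∀ i, (∀ l, idx l ≠ i) → b i = u i := fun i hi => replaced_other u idx A hi
  have hboff' : ∀ i, (∀ l, idx l ≠ i) → (u i).card ≤ t ∧ ∀ l, u i ≠ A l := by
    intro i hi
    rcases hU i with h' | ⟨l, hl⟩
    · exact h'
    · exact absurd (hslot i l hl) (Ne.symm (hi l))
  have hub : replaced b idx C = u := by
    funext i
    by_cases hi : ∃ l, idx l = i
    · obtain ⟨l, rfl⟩ := hi; rw [replaced_idx b hidxinj C l, hidx l]
    · have hi' : ∀ l, idx l ≠ i := fun l hl => hi ⟨l, hl⟩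
      rw [replaced_other b idx C hi', hboff i hi']
  have hbinj : Function.Injective b := by
    intro i i' hii'
    by_cases hi : ∃ l, idx l = i
    · obtain ⟨l, rfl⟩ := hi
      by_cases hi' : ∃ l', idx l' = i'
      · obtain ⟨l', rfl⟩ := hi'
        rw [hbslot, hbslot] at hii'; rw [hAinj hii']
      · have hi'' : ∀ l', idx l' ≠ i' := fun l' hl => hi' ⟨l', hl⟩
        rw [hbslot, hboff i' hi''] at hii'
        exact absurd hii'.symm ((hboff' i' hi'').2 l)
    · have hi1 : ∀ l, idx l ≠ i := fun l hl => hi ⟨l, hl⟩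
      by_cases hi' : ∃ l', idx l' = i'
      · obtain ⟨l', rfl⟩ := hi'
        rw [hboff i hi1, hbslot] at hii'
        exact absurd hii' ((hboff' i hi1).2 l')
      · have hi'' : ∀ l', idx l' ≠ i' := fun l' hl => hi' ⟨l', hl⟩
        rw [hboff i hi1, hboff i' hi''] at hii'
        exact hu hii'
  have hbcard : ∀ i, (b i).card ≤ t := by
    intro i
    by_cases hi : ∃ l, idx l = i
    · obtain ⟨l, rfl⟩ := hi; rw [hbslot, hA l]
    · have hi1 : ∀ l, idx l ≠ i := fun l hl => hi ⟨l, hl⟩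
      rw [hboff i hi1]; exact (hboff' i hi1).1
  have hbC : ∀ i l, b i ≠ C l := by
    intro i l hil
    have := hbcard i; rw [hil, hC l] at this; omega
  -- the m first-shell certificates
  have hdiag : ∀ l, (mat (tabM N (Pi.single l 1)) (Function.update b (idx l) (C l)) cols).det ≠ 0 := by
    intro l
    rw [hTl l]
    refine swapTable'_det_ne_zero (hk l) (A l) (C l) (e l) (m1 l) (m2 l) (m3 l) (m4 l) _ cols
      (update_injective b hbinj (idx l) (C l) (fun i => hbC i l)) ?_ (by rw [hkj l]; exact hcols)
    intro i
    by_cases hi : i = idx l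
    · right; rw [hi, Function.update_self]
    · left
      rw [Function.update_of_ne hi, hkj l]
      refine ⟨hbcard i, ?_⟩
      by_cases hi' : ∃ l', idx l' = i
      · obtain ⟨l', rfl⟩ := hi'
        rw [hbslot]; exact fun hh => hi (by rw [hAinj hh])
      · have hi1 : ∀ l', idx l' ≠ i := fun l' hl => hi' ⟨l', hl⟩
        rw [hboff i hi1]; exact (hboff' i hi1).2 l
  -- the vanishing cross minors, in key form
  have hzero : ∀ σ : Equiv.Perm (Fin m), σ ≠ 1 →
      ∃ l, ∀ ε, (mat (tabM N ε) (Function.update b (idx l) (C (σ l))) cols).det = 0 := by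
    intro σ hσ
    obtain ⟨l, hl⟩ := hZ σ hσ
    refine ⟨l, fun ε => hl _ (idx l) (Function.update_self _ _ _) ?_ hcolcard ε⟩
    intro R hR hRA
    by_cases hRA' : ∃ l', R = A l'
    · obtain ⟨l', rfl⟩ := hRA'
      have hll' : l' ≠ l := fun hh => hRA (by rw [hh])
      refine ⟨idx l', fun hh => hll' (hidxinj hh), ?_⟩
      rw [Function.update_of_ne (fun hh => hll' (hidxinj hh)), hbslot]
    · have hR𝒰 : R ∈ 𝒰 := by
        refine Finset.mem_union_left _ (Finset.mem_sdiff.2 ⟨Finset.mem_filter.2 ⟨Finset.mem_univ _, hR⟩, fun hx => ?_⟩)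
        obtain ⟨l', -, hl'⟩ := Finset.mem_image.1 hx
        exact hRA' ⟨l', hl'.symm⟩
      obtain ⟨i, hi⟩ := hhit R hR𝒰
      have hioff : ∀ l', idx l' ≠ i := by
        intro l' hh
        have : u i = C l' := by rw [← hh, hidx l']
        rw [hi] at this; rw [this, hC l'] at hR; omega
      refine ⟨i, (hioff l).symm, ?_⟩
      rw [Function.update_of_ne (hioff l).symm, hboff i hioff, hi]
  obtain ⟨tx, htx⟩ := exists_table_of_unique_matching hm N t b cols hbinj hbcard hcols hidxinj C hdiag hzero
  exact ⟨tx, by rw [hub] at htx; exact htx⟩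

/-- ★★ **THE m-SWAP MASTER TEMPLATE.**  Transports `e_l`, ONE potential for which every edge of every transport goes down (the union digraph
is acyclic), and for every permutation `σ ≠ 1` some `l` such that the cross minor `D(A_l ← C_{σ l})` — tokens on `C_{σ l}`, targets `A_l`,
edges of the union digraph — admits NO REDUCED CONFIGURATION ⇒ the m-th-shell family `B_t(h) ∖ {A_l} ∪ {C_l}` is served. -/
theorem exists_table_multiSwap_of_noReduced (h t : ℕ) {m : ℕ} (hm : 0 < m) (A C : Fin m → Finset (Fin h))
    (hA : ∀ l, (A l).card = t) (hC : ∀ l, (C l).card = t + 1)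
    (hAinj : Function.Injective A) (hCinj : Function.Injective C)
    {k j j' : Fin m → ℕ} (hk : ∀ l, 1 ≤ k l) (hkj : ∀ l, k l + j l = t)
    (e : ∀ l, (Fin (k l + 1) ⊕ Fin (k l)) ⊕ (Fin (j l) ⊕ Fin (j' l)) ≃ Fin h)
    (m1 : ∀ l x, e l (Sum.inl (Sum.inl x)) ∈ C l \ A l) (m2 : ∀ l i, e l (Sum.inl (Sum.inr i)) ∈ A l \ C l)
    (m3 : ∀ l z, e l (Sum.inr (Sum.inl z)) ∈ A l ∩ C l) (m4 : ∀ l x, e l (Sum.inr (Sum.inr x)) ∈ (A l ∪ C l)ᶜ)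
    (pot : Fin h → ℕ) (hdag : ∀ u v, u ≠ v → (∃ l, swapTable' (e l) u v ≠ 0) → pot v < pot u)
    (hnone : ∀ σ : Equiv.Perm (Fin m), σ ≠ 1 → ∃ l, ∀ f g : Fin h → Fin h, (∀ u, u ∉ C (σ l) → f u = u) →
        (∀ u ∈ C (σ l), f u ≠ u → ∃ l', swapTable' (e l') u (f u) ≠ 0) →
        (∀ u, g u ≠ u → ∃ l', swapTable' (e l') u (g u) ≠ 0) →
        ((C (σ l)).image f).card = t → Disjoint (mov g) (A l) → (C (σ l)).image f ⊆ A l ∪ mov g →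
        (mov g).image g = (A l ∪ mov g) \ (C (σ l)).image f →
        ∃ u ∈ C (σ l), u ∉ A l ∧ f u ∉ ((C (σ l)).erase u).image f ∧ (f u = u ↔ g u ≠ u))
    {r : ℕ} (u cols : Fin r → Finset (Fin h)) (hu : Function.Injective u)
    (hU : ∀ i, ((u i).card ≤ t ∧ ∀ l, u i ≠ A l) ∨ ∃ l, u i = C l)
    (hcols : ∀ J : Finset (Fin h), J.card ≤ t → ∃ kk, cols kk = J) :
    ∃ tx : Option (Fin h) → Fin h → ℂ,
      (Matrix.of fun i kk : Fin r => ∏ a ∈ u i, (tx none a + ∑ q ∈ cols kk, tx (some q) a)).det ≠ 0 := by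
  classical
  refine exists_table_multiSwap_of_cross h t hm A C hA hC hAinj hCinj hk hkj e m1 m2 m3 m4 u cols hu hU hcols ?_
  intro σ hσ
  obtain ⟨l, hl⟩ := hnone σ hσ
  refine ⟨l, fun rows i₀ hrow₀ key hcolcard ε => ?_⟩
  obtain ⟨hdiag, hedge⟩ := tabM_swapTable'_edges e ε
  exact det_eq_zero_of_no_reduced _ hdiag pot (fun a v hav hw => hdag a v hav (hedge a v hav hw)) t rows cols i₀
    (C (σ l)) (A l) hrow₀ (hC _) (hA l) key hcolcard fun f g h0 h1 h2 h3 h4 h5 h6 => hl f g h0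
      (fun a ha hfa => hedge a (f a) (Ne.symm hfa) (h1 a ha hfa)) (fun a hga => hedge a (g a) (Ne.symm hga) (h2 a hga)) h3 h4 h5 h6

end SecondShell

end

end Summit.ValiantsHypothesis.ValiantsHypothesis.Theorems.BarrierLever.HiddenStates
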